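import Summits.Ventures.YMGap.RobustBall.OneState
import Summits.Ventures.YMGap.RobustBall.MassGapOnBallZdGRowsSUN
import Summits.Ventures.YMGap.RobustBall.AreaLawRadiusPair
import HarnessLib

/-!
# Venture YMGap, track ROBUST-BALL — ONE STATE for `SU(3)` on `ℤ⁴`, HYPOTHESIS-FREE: the unique DLR state of every
# member of the gauge-invariant ball is its torus limit, massive AND area-law, at `β_W = 1/8, 1/6, 1/5, 1/4`

HONEST FRAMING. WHAT THIS IS: a venture file (cell `pub-ymgap`, track Y2 ROBUST-BALL, seat ds-3): the ONE-STATE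
theorem `oneState_onBallZdG` (`OneState.lean`) fed with ds-2's HYPOTHESIS-FREE `SU(3)` robust vertex-star rows on `ℤ⁴`
(`MassGapOnBallZdGRowsSUN.lean`, p2's eigen modulus — no H1/H2) and ds-4/rb-p2's hypothesis-free `SU(3)` Bakry–Émery
area law on the ball (`su3_areaLawOnBall_radius_bePair`: `AreaLawOnBall 3 4 (β_W/3) (2ε) ε r mv` with
`ε(β_W) = (3 − 8β_W)/(4(3 − 4β_W))`, whose ball contains every star cell's radii). CELLS (`SU(3)`, `d = 4`, Wilson
`β_W`, gauge-invariant tier-1 ball `MemBallZdG (2ε) ε R`): `(1/8, .148)`, `(1/6, .104)`, `(1/5, .069)`, `(1/4, .019)`: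
for every member ONE probability measure is at once the unique DLR state and the infinite-volume limit of the member's
PERIODISED torus states; it is an Osterwalder–Seiler massive state with plaquette–plaquette decay AND obeys Wilson's
area law; for each range `R` one pair `(C, c)`, `c > 0`, serves every member of range `≤ R` (slab window `2R + 1`).
WHAT IT IS NOT: no H1/H2 anywhere; existence of the string tension is not claimed; strong-coupling lattice statements;
nothing about the continuum limit or the Clay Millennium problem.

References: ds-2 `MassGapOnBallZdGRowsSUN.lean`; `AreaLawRadiusPair.lean` (`su3_areaLawOnBall_radius_bePair`); ds-3
`OneState.lean`.
-/

noncomputable section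

open MeasureTheory Filter Topology Function Finset
open scoped NNReal
open Literature.Probability.LatticeModels
open Literature.MathematicalPhysics.QuantumLattice hiding torusNorm
open Literature.MathematicalPhysics.QuantumFieldTheory hiding ZdEdge Site
open Literature.Barriers.QuantumFields (IsMassiveState)
open Summit.Ventures.YMGap.RobustBallPair (su3_areaLawOnBall_radius_bePair)

namespace Summit.Ventures.YMGap.RobustBall

/-- **`SU(3)`, `d = 4` ONE-STATE SCHEMA, hypothesis-free**: a `MassGapOnBallZdG 4 3 β ε₀ ε₁ R` row at Wilson coupling
`β_W = 9β ∈ [0, 3/8)` (tree coupling `3β = β_W/3`) with radii inside the Bakry–Émery area-law ball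
`(2ε(β_W), ε(β_W))`, `ε(β_W) = (3 − 8β_W)/(4(3 − 4β_W))`, gives: for each range `R` one `(C, c)`, `c > 0`, such that
every member of `MemBallZdG ε₀ ε₁ R` has ONE state, massive with plaquette–plaquette decay and `HasAreaLawWith μ χ₃ C c`.
[folklore] -/
theorem su3_oneState_of_star_row {βW ε₀ ε₁ : ℝ} {R : ℕ} (hε₀ : 0 ≤ ε₀) (hε₁ : 0 ≤ ε₁) (hβ0 : 0 ≤ βW) (hβ : βW < 3 / 8)
    (h₀ : ε₀ ≤ 2 * ((3 - 8 * βW) / (4 * (3 - 4 * βW)))) (h₁ : ε₁ ≤ (3 - 8 * βW) / (4 * (3 - 4 * βW)))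
    (hgap : MassGapOnBallZdG 4 3 (βW / 9) ε₀ ε₁ R) :
    ∃ C c : ℝ, 0 < c ∧ ∀ (W : Potential (ZdEdge 4) (SUN 3)) (supp : Finset (ZdEdge 4) → Finset (Finset (ZdEdge 4)))
      (hmem : MemBallZdG ε₀ ε₁ R W supp) (hdep : ∀ X, DependsOn (W X) (↑X : Set (ZdEdge 4)))
      (hg : ∀ X, IsZdGaugeInvariant (W X)) (hm : ∀ X, Measurable (W X)) (hb : ∀ X, ∃ C, ∀ U, |W X U| ≤ C),
      ∃ μ : Measure (LGConfig 4 (SUN 3)),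
        perturbedGibbsMeasures (d := 4) (fundamentalRep (Fin 3)) (((3 : ℕ) : ℝ) * (βW / 9)) W supp = {μ} ∧
        perturbedLimitPoints (((3 : ℕ) : ℝ) * (βW / 9)) (periodisedFamily W supp hdep hg hm hb) = {μ} ∧
        IsMassiveState μ ∧ HasExponentialDecay (plaquetteCorrFn (fundamentalRep (Fin 3)) μ) ∧
        HasAreaLawWith μ (fun g => normalisedCharacter 3 (fundamentalRep (Fin 3) g)) C c := by
  have hA := su3_areaLawOnBall_radius_bePair hβ0 hβ R (mv := 2 * R + 1) (by omega)
  have e : βW / 3 = ((3 : ℕ) : ℝ) * (βW / 9) := by push_cast; ring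
  rw [e] at hA
  exact oneState_onBallZdG (N := 3) (by norm_num) hε₀ hε₁ hgap (hA.anti h₀ h₁ le_rfl le_rfl)

/-- ★ **`SU(3)`, `ℤ⁴`, `β_W = 1/8`, HYPOTHESIS-FREE**: every member of the gauge-invariant tier-1 ball `MemBallZdG 0.296 0.148 R`
(oscillation load `≤ .296`, site-incidence Lipschitz load `≤ .148`, range `R`) added to `SU(3)` Wilson at `β_W = 1/8`
('t Hooft `1/72`, tree `1/24`) has ONE state — the unique DLR state = the infinite-volume limit of its PERIODISED torus
states — massive with plaquette–plaquette decay AND area-law, for each `R` one `(C, c)` (ds-2's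
`su3_massGapOnBallZdG_star_oneEighth` × `su3_areaLawOnBall_radius_bePair`). [folklore] -/
theorem su3_oneState_star_oneEighth (R : ℕ) :
    ∃ C c : ℝ, 0 < c ∧ ∀ (W : Potential (ZdEdge 4) (SUN 3)) (supp : Finset (ZdEdge 4) → Finset (Finset (ZdEdge 4)))
      (hmem : MemBallZdG (37 / 125) (37 / 250) R W supp) (hdep : ∀ X, DependsOn (W X) (↑X : Set (ZdEdge 4)))
      (hg : ∀ X, IsZdGaugeInvariant (W X)) (hm : ∀ X, Measurable (W X)) (hb : ∀ X, ∃ C, ∀ U, |W X U| ≤ C),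
      ∃ μ : Measure (LGConfig 4 (SUN 3)),
        perturbedGibbsMeasures (d := 4) (fundamentalRep (Fin 3)) (((3 : ℕ) : ℝ) * ((1 / 8 : ℝ) / 9)) W supp = {μ} ∧
        perturbedLimitPoints (((3 : ℕ) : ℝ) * ((1 / 8 : ℝ) / 9)) (periodisedFamily W supp hdep hg hm hb) = {μ} ∧
        IsMassiveState μ ∧ HasExponentialDecay (plaquetteCorrFn (fundamentalRep (Fin 3)) μ) ∧
        HasAreaLawWith μ (fun g => normalisedCharacter 3 (fundamentalRep (Fin 3) g)) C c := by
  have hgap : MassGapOnBallZdG 4 3 ((1 / 8 : ℝ) / 9) (37 / 125) (37 / 250) R := by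
    have h := su3_massGapOnBallZdG_star_oneEighth R; norm_num at h ⊢; exact h
  exact su3_oneState_of_star_row (by norm_num) (by norm_num) (by norm_num) (by norm_num) (by norm_num) (by norm_num) hgap

/-- **`SU(3)`, `ℤ⁴`, `β_W = 1/6`, hypothesis-free**: ONE state, massive and area-law, on `MemBallZdG 0.208 0.104 R`
('t Hooft `1/54`). [folklore] -/
theorem su3_oneState_star_oneSixth (R : ℕ) :
    ∃ C c : ℝ, 0 < c ∧ ∀ (W : Potential (ZdEdge 4) (SUN 3)) (supp : Finset (ZdEdge 4) → Finset (Finset (ZdEdge 4)))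
      (hmem : MemBallZdG (26 / 125) (13 / 125) R W supp) (hdep : ∀ X, DependsOn (W X) (↑X : Set (ZdEdge 4)))
      (hg : ∀ X, IsZdGaugeInvariant (W X)) (hm : ∀ X, Measurable (W X)) (hb : ∀ X, ∃ C, ∀ U, |W X U| ≤ C),
      ∃ μ : Measure (LGConfig 4 (SUN 3)),
        perturbedGibbsMeasures (d := 4) (fundamentalRep (Fin 3)) (((3 : ℕ) : ℝ) * ((1 / 6 : ℝ) / 9)) W supp = {μ} ∧
        perturbedLimitPoints (((3 : ℕ) : ℝ) * ((1 / 6 : ℝ) / 9)) (periodisedFamily W supp hdep hg hm hb) = {μ} ∧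
        IsMassiveState μ ∧ HasExponentialDecay (plaquetteCorrFn (fundamentalRep (Fin 3)) μ) ∧
        HasAreaLawWith μ (fun g => normalisedCharacter 3 (fundamentalRep (Fin 3) g)) C c := by
  have hgap : MassGapOnBallZdG 4 3 ((1 / 6 : ℝ) / 9) (26 / 125) (13 / 125) R := by
    have h := su3_massGapOnBallZdG_star_oneSixth R; norm_num at h ⊢; exact h
  exact su3_oneState_of_star_row (by norm_num) (by norm_num) (by norm_num) (by norm_num) (by norm_num) (by norm_num) hgap

/-- **`SU(3)`, `ℤ⁴`, `β_W = 1/5`, hypothesis-free**: ONE state, massive and area-law, on `MemBallZdG 0.138 0.069 R`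
('t Hooft `1/45`). [folklore] -/
theorem su3_oneState_star_oneFifth (R : ℕ) :
    ∃ C c : ℝ, 0 < c ∧ ∀ (W : Potential (ZdEdge 4) (SUN 3)) (supp : Finset (ZdEdge 4) → Finset (Finset (ZdEdge 4)))
      (hmem : MemBallZdG (69 / 500) (69 / 1000) R W supp) (hdep : ∀ X, DependsOn (W X) (↑X : Set (ZdEdge 4)))
      (hg : ∀ X, IsZdGaugeInvariant (W X)) (hm : ∀ X, Measurable (W X)) (hb : ∀ X, ∃ C, ∀ U, |W X U| ≤ C),
      ∃ μ : Measure (LGConfig 4 (SUN 3)),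
        perturbedGibbsMeasures (d := 4) (fundamentalRep (Fin 3)) (((3 : ℕ) : ℝ) * ((1 / 5 : ℝ) / 9)) W supp = {μ} ∧
        perturbedLimitPoints (((3 : ℕ) : ℝ) * ((1 / 5 : ℝ) / 9)) (periodisedFamily W supp hdep hg hm hb) = {μ} ∧
        IsMassiveState μ ∧ HasExponentialDecay (plaquetteCorrFn (fundamentalRep (Fin 3)) μ) ∧
        HasAreaLawWith μ (fun g => normalisedCharacter 3 (fundamentalRep (Fin 3) g)) C c := by
  have hgap : MassGapOnBallZdG 4 3 ((1 / 5 : ℝ) / 9) (69 / 500) (69 / 1000) R := by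
    have h := su3_massGapOnBallZdG_star_oneFifth R; norm_num at h ⊢; exact h
  exact su3_oneState_of_star_row (by norm_num) (by norm_num) (by norm_num) (by norm_num) (by norm_num) (by norm_num) hgap

/-- ★ **`SU(3)`, `ℤ⁴`, `β_W = 1/4`, hypothesis-free**: ONE state, massive and area-law, on `MemBallZdG 0.038 0.019 R`
('t Hooft `1/36`) — the top of the certified hypothesis-free `SU(3)` star window on `ℤ⁴`. [folklore] -/
theorem su3_oneState_star_oneQuarter (R : ℕ) :
    ∃ C c : ℝ, 0 < c ∧ ∀ (W : Potential (ZdEdge 4) (SUN 3)) (supp : Finset (ZdEdge 4) → Finset (Finset (ZdEdge 4)))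
      (hmem : MemBallZdG (19 / 500) (19 / 1000) R W supp) (hdep : ∀ X, DependsOn (W X) (↑X : Set (ZdEdge 4)))
      (hg : ∀ X, IsZdGaugeInvariant (W X)) (hm : ∀ X, Measurable (W X)) (hb : ∀ X, ∃ C, ∀ U, |W X U| ≤ C),
      ∃ μ : Measure (LGConfig 4 (SUN 3)),
        perturbedGibbsMeasures (d := 4) (fundamentalRep (Fin 3)) (((3 : ℕ) : ℝ) * ((1 / 4 : ℝ) / 9)) W supp = {μ} ∧
        perturbedLimitPoints (((3 : ℕ) : ℝ) * ((1 / 4 : ℝ) / 9)) (periodisedFamily W supp hdep hg hm hb) = {μ} ∧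
        IsMassiveState μ ∧ HasExponentialDecay (plaquetteCorrFn (fundamentalRep (Fin 3)) μ) ∧
        HasAreaLawWith μ (fun g => normalisedCharacter 3 (fundamentalRep (Fin 3) g)) C c := by
  have hgap : MassGapOnBallZdG 4 3 ((1 / 4 : ℝ) / 9) (19 / 500) (19 / 1000) R := by
    have h := su3_massGapOnBallZdG_star_oneQuarter R; norm_num at h ⊢; exact h
  exact su3_oneState_of_star_row (by norm_num) (by norm_num) (by norm_num) (by norm_num) (by norm_num) (by norm_num) hgap

end Summit.Ventures.YMGap.RobustBall

end
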